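import Summits.NavierStokesRegularity.NavierStokesRegularity.Theorems.ExtremiserTransienceNearExtremalTransienceExtremiserLiouvilleConstantSpeedPiolaSlide
import Summits.NavierStokesRegularity.NavierStokesRegularity.Theorems.ExtremiserTransienceNearExtremalTransienceExtremiserLiouvilleConstantSpeedSlideGenerator
import Literature.Analysis.Calculus.HadamardLemma
import HarnessLib

/-!
# Crux `ExtremiserTransience.NearExtremalTransience` (stmt-NavierStokesRegularity-21883), line `extremiser_liouville`,
# stub K1b — THE DISCRETE SLIDE DIRECTION `φ̂_h` (blueprint L1): divergence free and EXACTLY inward pointing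

`--supports stmt-NavierStokesRegularity-21883` (helper).  Author: prover seat `ns-el-k1b` (g8).  Record:
`Cruxes/NearExtremalTransience/Lines/extremiser_liouville_k1b_slide.md` §1(a), §11 (L1/L2).

WHY.  The KKT inequality on g5's global convex class (`ext_firstVariation_le_of_inner_le_global`,
`…ConstantSpeedGlobalVariation`) needs the direction's `D²` in `L²`; the slide generator `φ_g = g(x₂)∂₂V + g′(x₂)V_h` has
`D²φ_g ∋ gD³V`, which the residue object does not supply.  The cure is the DISCRETE SLIDE DIRECTION (all `h > 0`)
```
  φ̂_h(x) = g(x₂)V(x) − g(x₂ − h)V(x − he₂) − ( ∫_{−h}^{0} g′(x₂ + t)·V₂(x + te₂) dt )·e₂      ( h⁻¹φ̂_h → φ_g as h → 0 ),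
```
built only from `V`, its vertical translate and a vertical sliding integral of `g′V₂` (so `Dᵏφ̂_h` needs only `DᵏV`, `k ≤ 2`):
* `fderiv_verticalIntegral_apply` : `∂₂ ∫_{−h}^{0} G(x + te₂)dt = G(x) − G(x − he₂)` (FTC along `e₂`; `G ∈ C¹`).
* `isDivFree_slideQuotient` : **`div φ̂_h = 0`** (`div(gV) = g′V₂`, and the `e₂`-derivative of the sliding integral
  is exactly the backward difference of `g′V₂`).
* `inner_slideQuotient_nonneg` : **`⟪c + V(x), φ̂_h(x)⟫ ≥ 0`** whenever `‖V(x)‖² ≤ 2M²` (in particular on far-field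
  layers), for `‖c + V‖ ≡ M = ‖c‖`, `c = (0,0,c₂)`, `g, g′ ≥ 0`, `h ≥ 0`: the three pieces are
  `g(x₂−h)⟪w, w − w(·−he₂)⟫ ≥ 0` (Cauchy–Schwarz, `inner_self_sub_translate_nonneg`), `(g(x₂) − g(x₂−h))·‖V‖²/2 ≥ 0`
  (monotone `g`), and `−(c₂ + V₂(x))∫g′V₂ = (1 − ‖V(x)‖²/2M²)·½∫_{−h}^{0}g′‖V‖² ≥ 0` (`c₂V₂ = −‖V‖²/2`).
  So `ψ = −φ̂_h` satisfies the hypothesis `⟪v, ψ⟫ ≤ 0` of the global KKT lemma with NO `h`-error: `ℓ(φ̂_h) ≥ 0` exactly.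
(Smoothness and the uniform bounds of `φ̂_h`, `Dφ̂_h` are in the sequel `…SlideQuotientBounds`.)

WHAT THIS IS NOT: K1b is NOT proved; nothing here proves NS regularity. [folklore]
-/

noncomputable section

open Set Filter Topology MeasureTheory Metric Function InnerProductSpace
open scoped ENNReal NNReal Topology InnerProductSpace RealInnerProductSpace ContDiff
open Literature.Analysis.FluidPDE Literature.Analysis

namespace Summit.NavierStokesRegularity.NavierStokesRegularity.Theorems

-- the problem directory repeats the summit name (`NavierStokesRegularity/NavierStokesRegularity`)
set_option linter.dupNamespace false

namespace ExtremiserLiouville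

open DepletionLadder.KStar

variable {V : EuclideanSpace ℝ (Fin 3) → EuclideanSpace ℝ (Fin 3)} {c : EuclideanSpace ℝ (Fin 3)} {g : ℝ → ℝ}

/-! ## 1. The vertical sliding integral and its `e₂`-derivative -/

/-- Scalar vertical segments: `t ↦ G(x + te₂)` has derivative `∂₂G(x + te₂)`. [folklore] -/
theorem hasDerivAt_scalar_comp_add_smul {G : EuclideanSpace ℝ (Fin 3) → ℝ} (hG : Differentiable ℝ G)
    (x : EuclideanSpace ℝ (Fin 3)) (t : ℝ) :
    HasDerivAt (fun t : ℝ => G (x + t • EuclideanSpace.single (2 : Fin 3) (1 : ℝ)))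
      (fderiv ℝ G (x + t • EuclideanSpace.single (2 : Fin 3) (1 : ℝ)) (EuclideanSpace.single (2 : Fin 3) (1 : ℝ))) t := by
  set e₂ : EuclideanSpace ℝ (Fin 3) := EuclideanSpace.single (2 : Fin 3) (1 : ℝ) with he₂
  have hl : HasDerivAt (fun t : ℝ => x + t • e₂) ((1 : ℝ) • e₂) t := ((hasDerivAt_id t).smul_const e₂).const_add x
  rw [one_smul] at hl
  exact (hG (x + t • e₂)).hasFDerivAt.comp_hasDerivAt t hl

/-- The integrand `(y, t) ↦ G(y + te₂)` of the sliding integral is `Cⁿ` when `G` is. [folklore] -/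
theorem contDiff_uncurry_comp_add_smul {G : EuclideanSpace ℝ (Fin 3) → ℝ} {n : WithTop ℕ∞} (hG : ContDiff ℝ n G) :
    ContDiff ℝ n (uncurry fun (y : EuclideanSpace ℝ (Fin 3)) (t : ℝ) =>
      G (y + t • EuclideanSpace.single (2 : Fin 3) (1 : ℝ))) := by
  have h : ContDiff ℝ n fun p : EuclideanSpace ℝ (Fin 3) × ℝ => p.1 + p.2 • EuclideanSpace.single (2 : Fin 3) (1 : ℝ) :=
    contDiff_fst.add (contDiff_snd.smul contDiff_const)
  exact hG.comp h

/-- The sliding integral `y ↦ ∫_{a}^{b} G(y + te₂)dt` is differentiable (`G ∈ C¹`). [folklore] -/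
theorem differentiable_verticalIntegral {G : EuclideanSpace ℝ (Fin 3) → ℝ} (hG : ContDiff ℝ 1 G) (a b : ℝ) :
    Differentiable ℝ fun y : EuclideanSpace ℝ (Fin 3) =>
      ∫ t in a..b, G (y + t • EuclideanSpace.single (2 : Fin 3) (1 : ℝ)) := fun y =>
  (Literature.Analysis.Calculus.hasFDerivAt_intervalIntegral_partialFDerivFst
    (contDiff_uncurry_comp_add_smul hG) one_ne_zero a b y).differentiableAt

/-- **FTC along `e₂` for the sliding integral**: `D(∫_{a}^{b} G(· + te₂)dt)(x)·e₂ = G(x + be₂) − G(x + ae₂)` (`G ∈ C¹`).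
[folklore] -/
theorem fderiv_verticalIntegral_apply {G : EuclideanSpace ℝ (Fin 3) → ℝ} (hG : ContDiff ℝ 1 G) (a b : ℝ)
    (x : EuclideanSpace ℝ (Fin 3)) :
    fderiv ℝ (fun y : EuclideanSpace ℝ (Fin 3) => ∫ t in a..b, G (y + t • EuclideanSpace.single (2 : Fin 3) (1 : ℝ))) x
        (EuclideanSpace.single (2 : Fin 3) (1 : ℝ)) =
      G (x + b • EuclideanSpace.single (2 : Fin 3) (1 : ℝ)) - G (x + a • EuclideanSpace.single (2 : Fin 3) (1 : ℝ)) := by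
  set e₂ : EuclideanSpace ℝ (Fin 3) := EuclideanSpace.single (2 : Fin 3) (1 : ℝ) with he₂
  have hF := contDiff_uncurry_comp_add_smul hG
  rw [Literature.Analysis.Calculus.fderiv_intervalIntegral_apply_eq_partialFDerivFst hF one_ne_zero a b x e₂]
  have hpt : ∀ t : ℝ, Literature.Analysis.Calculus.partialFDerivFst
      (fun (y : EuclideanSpace ℝ (Fin 3)) (t : ℝ) => G (y + t • e₂)) x t e₂ = fderiv ℝ G (x + t • e₂) e₂ := by
    intro t
    rw [← Literature.Analysis.Calculus.fderiv_eq_partialFDerivFst hF one_ne_zero x t]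
    show fderiv ℝ (fun y : EuclideanSpace ℝ (Fin 3) => G (y + t • e₂)) x e₂ = fderiv ℝ G (x + t • e₂) e₂
    rw [fderiv_comp_add_right]
  rw [intervalIntegral.integral_congr (g := fun t => fderiv ℝ G (x + t • e₂) e₂) (fun t _ => hpt t)]
  have hGd : Differentiable ℝ G := hG.differentiable one_ne_zero
  have hcont : Continuous fun t : ℝ => fderiv ℝ G (x + t • e₂) e₂ :=
    ((hG.continuous_fderiv one_ne_zero).comp (continuous_const.add (continuous_id.smul continuous_const))).clm_apply
      continuous_const
  exact intervalIntegral.integral_eq_sub_of_hasDerivAt (fun t _ => hasDerivAt_scalar_comp_add_smul hGd x t)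
    (hcont.intervalIntegrable _ _)

/-! ## 2. The discrete slide direction is divergence free -/

/-- `div(g(x₂)V) = g′(x₂)V₂` for a divergence-free `V`. [folklore] -/
theorem divergence_axialWeight_smul (hVd : Differentiable ℝ V) (hdiv : VectorCalculus.IsDivFree V)
    (hgd : Differentiable ℝ g) (x : EuclideanSpace ℝ (Fin 3)) :
    VectorCalculus.divergence (fun y : EuclideanSpace ℝ (Fin 3) => g (y 2) • V y) x = deriv g (x 2) * V x 2 := by
  have haD : HasFDerivAt (fun y : EuclideanSpace ℝ (Fin 3) => g (y 2)) (deriv g (x 2) •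
      (EuclideanSpace.proj (2 : Fin 3) : EuclideanSpace ℝ (Fin 3) →L[ℝ] ℝ)) x := hasFDerivAt_comp_coord hgd 2 x
  rw [Literature.Analysis.FluidPDE.divergence_smul_apply haD.differentiableAt (hVd x), hdiv x, mul_zero, zero_add,
    real_inner_comm, gradient, InnerProductSpace.toDual_symm_apply, haD.fderiv]
  rfl

/-- **The discrete slide direction is divergence free**: for `V ∈ C¹` divergence free and `g ∈ C²`,
`div( g(x₂)V − g(x₂−h)V(·−he₂) − (∫_{−h}^{0} g′(x₂+t)V₂(·+te₂)dt)e₂ ) = 0`. [folklore] -/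
theorem isDivFree_slideQuotient (hV : ContDiff ℝ 1 V) (hdiv : VectorCalculus.IsDivFree V) (hg : ContDiff ℝ 2 g) (h : ℝ) :
    VectorCalculus.IsDivFree fun x : EuclideanSpace ℝ (Fin 3) =>
      g (x 2) • V x - g ((x + (-h) • EuclideanSpace.single (2 : Fin 3) (1 : ℝ)) 2) •
          V (x + (-h) • EuclideanSpace.single (2 : Fin 3) (1 : ℝ)) -
        (∫ t in (-h)..0, deriv g ((x + t • EuclideanSpace.single (2 : Fin 3) (1 : ℝ)) 2) *
            V (x + t • EuclideanSpace.single (2 : Fin 3) (1 : ℝ)) 2) • EuclideanSpace.single (2 : Fin 3) (1 : ℝ) := by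
  set e₂ : EuclideanSpace ℝ (Fin 3) := EuclideanSpace.single (2 : Fin 3) (1 : ℝ) with he₂
  have hVd : Differentiable ℝ V := hV.differentiable one_ne_zero
  have hgd : Differentiable ℝ g := hg.differentiable two_ne_zero
  have hg'c : ContDiff ℝ 1 (deriv g) := by
    have h2 : ContDiff ℝ (1 + 1) g := by rw [show ((1 : WithTop ℕ∞) + 1) = 2 by norm_num]; exact hg
    exact h2.deriv'
  set Ψ : EuclideanSpace ℝ (Fin 3) → EuclideanSpace ℝ (Fin 3) := fun y => g (y 2) • V y with hΨ
  set G : EuclideanSpace ℝ (Fin 3) → ℝ := fun y => deriv g (y 2) * V y 2 with hG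
  set F : EuclideanSpace ℝ (Fin 3) → ℝ := fun y => ∫ t in (-h)..0, G (y + t • e₂) with hF
  have hGc : ContDiff ℝ 1 G := by
    have h1 : ContDiff ℝ 1 fun y : EuclideanSpace ℝ (Fin 3) => deriv g (y 2) :=
      hg'c.comp ((EuclideanSpace.proj (2 : Fin 3) : EuclideanSpace ℝ (Fin 3) →L[ℝ] ℝ).contDiff)
    have h2 : ContDiff ℝ 1 fun y : EuclideanSpace ℝ (Fin 3) => V y 2 :=
      (EuclideanSpace.proj (2 : Fin 3) : EuclideanSpace ℝ (Fin 3) →L[ℝ] ℝ).contDiff.comp hV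
    exact h1.mul h2
  have had : Differentiable ℝ fun y : EuclideanSpace ℝ (Fin 3) => g (y 2) := fun y =>
    (hasFDerivAt_comp_coord hgd 2 y).differentiableAt
  have hΨd : Differentiable ℝ Ψ := had.smul hVd
  set Ψa : EuclideanSpace ℝ (Fin 3) → EuclideanSpace ℝ (Fin 3) := fun y => Ψ (y + (-h) • e₂) with hΨa
  have hΨad : Differentiable ℝ Ψa := hΨd.comp (differentiable_id.add_const _)
  have hFd : Differentiable ℝ F := differentiable_verticalIntegral hGc (-h) 0
  set Fe : EuclideanSpace ℝ (Fin 3) → EuclideanSpace ℝ (Fin 3) := fun y => F y • e₂ with hFe'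
  have hFe : Differentiable ℝ Fe := hFd.smul_const e₂
  set Φ₁ : EuclideanSpace ℝ (Fin 3) → EuclideanSpace ℝ (Fin 3) := fun y => Ψ y + (-1 : ℝ) • Ψa y with hΦ₁
  have hΦ₁d : Differentiable ℝ Φ₁ := fun y => (hΨd y).add ((hΨad y).const_smul (-1 : ℝ))
  intro x
  have hsplit : (fun y : EuclideanSpace ℝ (Fin 3) => g (y 2) • V y - g ((y + (-h) • e₂) 2) • V (y + (-h) • e₂) -
      (∫ t in (-h)..0, deriv g ((y + t • e₂) 2) * V (y + t • e₂) 2) • e₂) =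
      fun y => Φ₁ y + (-1 : ℝ) • Fe y := by
    funext y
    simp only [hΦ₁, hΨa, hΨ, hFe', hF, hG]
    module
  rw [hsplit, divergence_add_smul hΦ₁d hFe (-1) x]
  have h12 : VectorCalculus.divergence Φ₁ x =
      VectorCalculus.divergence Ψ x + (-1) * VectorCalculus.divergence Ψa x :=
    divergence_add_smul hΨd hΨad _ x
  have hdivΨ : ∀ y, VectorCalculus.divergence Ψ y = deriv g (y 2) * V y 2 := fun y =>
    divergence_axialWeight_smul hVd hdiv hgd y
  have hdivΨa : VectorCalculus.divergence Ψa x = VectorCalculus.divergence Ψ (x + (-h) • e₂) := by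
    simp only [hΨa]
    unfold VectorCalculus.divergence
    rw [fderiv_comp_add_right]
  have hdivF : VectorCalculus.divergence Fe x = G (x + (0 : ℝ) • e₂) - G (x + (-h) • e₂) := by
    simp only [hFe']
    rw [Literature.Analysis.FluidPDE.divergence_smul_apply (hFd x) (differentiableAt_const e₂)]
    have hdivconst : VectorCalculus.divergence (fun _ : EuclideanSpace ℝ (Fin 3) => e₂) x = 0 := by
      rw [divergence_eq_sum_three]; simp
    rw [hdivconst, mul_zero, zero_add, real_inner_comm, gradient, InnerProductSpace.toDual_symm_apply]
    exact fderiv_verticalIntegral_apply hGc (-h) 0 x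
  rw [h12, hdivΨ, hdivΨa, hdivΨ, hdivF, zero_smul, add_zero]
  simp only [hG]
  ring

/-! ## 3. The discrete slide direction points inward, exactly -/

/-- `c₂V₂ = −‖V‖²/2` and `‖c + V‖ ≡ ‖c‖` for the residue field (`⟪V, c⟫ = −‖V‖²/2`, `c = (0,0,c₂)`). [folklore] -/
theorem coord_two_mul_coord_two_eq (hVc : ∀ y, ⟪V y, c⟫ = -(‖V y‖ ^ 2 / 2)) (hc0 : c 0 = 0) (hc1 : c 1 = 0)
    (y : EuclideanSpace ℝ (Fin 3)) : c 2 * V y 2 = -(‖V y‖ ^ 2 / 2) ∧ ‖c + V y‖ = ‖c‖ := by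
  have h2 : ⟪V y, c⟫ = c 2 * V y 2 := by
    simp only [PiLp.inner_apply, RCLike.inner_apply, conj_trivial, Fin.sum_univ_three, hc0, hc1]; ring
  refine ⟨by rw [← h2, hVc], ?_⟩
  have h1 : ‖c + V y‖ ^ 2 = ‖c‖ ^ 2 := by
    rw [norm_add_sq_real, real_inner_comm, hVc]; ring
  exact (pow_left_inj₀ (norm_nonneg _) (norm_nonneg _) two_ne_zero).1 h1

/-- **The discrete slide direction points inward, exactly**: for the residue field (`⟪V, c⟫ = −‖V‖²/2`, `c = (0,0,c₂) ≠ 0`),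
`g, g′ ≥ 0`, `h ≥ 0`, at every point with `‖V(x)‖² ≤ 2‖c‖²`:
`0 ≤ ⟪c + V(x), g(x₂)V(x) − g(x₂−h)V(x−he₂) − (∫_{−h}^{0} g′(x₂+t)V₂(x+te₂)dt)e₂⟫`. [folklore] -/
theorem inner_slideQuotient_nonneg (hVc : ∀ y, ⟪V y, c⟫ = -(‖V y‖ ^ 2 / 2)) (hc0 : c 0 = 0) (hc1 : c 1 = 0)
    (hc : 0 < ‖c‖) (hgd : Differentiable ℝ g) (hg0 : ∀ s, 0 ≤ g s) (hγ0 : ∀ s, 0 ≤ deriv g s)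
    {h : ℝ} (hh : 0 ≤ h) {x : EuclideanSpace ℝ (Fin 3)} (hfar : ‖V x‖ ^ 2 ≤ 2 * ‖c‖ ^ 2) :
    0 ≤ ⟪c + V x, g (x 2) • V x - g ((x + (-h) • EuclideanSpace.single (2 : Fin 3) (1 : ℝ)) 2) •
          V (x + (-h) • EuclideanSpace.single (2 : Fin 3) (1 : ℝ)) -
        (∫ t in (-h)..0, deriv g ((x + t • EuclideanSpace.single (2 : Fin 3) (1 : ℝ)) 2) *
            V (x + t • EuclideanSpace.single (2 : Fin 3) (1 : ℝ)) 2) • EuclideanSpace.single (2 : Fin 3) (1 : ℝ)⟫ := by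
  set e₂ : EuclideanSpace ℝ (Fin 3) := EuclideanSpace.single (2 : Fin 3) (1 : ℝ) with he₂
  have hcV : ∀ y, c 2 * V y 2 = -(‖V y‖ ^ 2 / 2) := fun y => (coord_two_mul_coord_two_eq hVc hc0 hc1 y).1
  have hM : ∀ y, ‖c + V y‖ = ‖c‖ := fun y => (coord_two_mul_coord_two_eq hVc hc0 hc1 y).2
  have hc2sq : c 2 ^ 2 = ‖c‖ ^ 2 := by
    rw [EuclideanSpace.norm_sq_eq, Fin.sum_univ_three, hc0, hc1]
    simp [Real.norm_eq_abs, sq_abs]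
  set a : EuclideanSpace ℝ (Fin 3) := (-h) • e₂ with ha
  set F : ℝ := ∫ t in (-h)..0, deriv g ((x + t • e₂) 2) * V (x + t • e₂) 2 with hF
  -- the three pairings
  have hwV : ⟪c + V x, V x⟫ = ‖V x‖ ^ 2 / 2 := by
    rw [inner_add_left, real_inner_self_eq_norm_sq, real_inner_comm, hVc]; ring
  have hwe : ⟪c + V x, e₂⟫ = c 2 + V x 2 := by
    rw [he₂, EuclideanSpace.inner_single_right]; simp
  have hT1 : ⟪c + V x, V (x + a)⟫ ≤ ‖V x‖ ^ 2 / 2 := by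
    have h0 := inner_self_sub_translate_nonneg (w := fun y => c + V y) hM x (x + a)
    have e : (c + V x) - (c + V (x + a)) = V x - V (x + a) := by abel
    simp only [e, inner_sub_right] at h0
    linarith [hwV]
  have ha2 : (x + a) 2 = x 2 - h := by
    simp [ha, he₂]; ring
  have hmono : g (x 2 - h) ≤ g (x 2) := (monotone_of_deriv_nonneg hgd hγ0) (by linarith)
  -- the sliding integral has the favourable sign
  have hI : c 2 * F ≤ 0 := by
    rw [hF, ← intervalIntegral.integral_const_mul]
    have hpt : ∀ t : ℝ, c 2 * (deriv g ((x + t • e₂) 2) * V (x + t • e₂) 2) =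
        -(deriv g ((x + t • e₂) 2) * (‖V (x + t • e₂)‖ ^ 2 / 2)) := by
      intro t; rw [mul_left_comm, hcV]; ring
    simp_rw [hpt, intervalIntegral.integral_neg, neg_nonpos]
    exact intervalIntegral.integral_nonneg (by linarith) fun t _ => mul_nonneg (hγ0 _) (by positivity)
  have hcc : 0 ≤ c 2 * (c 2 + V x 2) := by
    have : c 2 * (c 2 + V x 2) = ‖c‖ ^ 2 - ‖V x‖ ^ 2 / 2 := by rw [mul_add, hcV, ← hc2sq]; ring
    rw [this]; linarith
  have hT3 : 0 ≤ -(F * (c 2 + V x 2)) := by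
    have h3 : 0 ≤ c 2 ^ 2 * (-(F * (c 2 + V x 2))) := by
      have : c 2 ^ 2 * (-(F * (c 2 + V x 2))) = (-(c 2 * F)) * (c 2 * (c 2 + V x 2)) := by ring
      rw [this]; exact mul_nonneg (by linarith) hcc
    have hpos : 0 < c 2 ^ 2 := by rw [hc2sq]; positivity
    exact (mul_nonneg_iff_of_pos_left hpos).1 h3
  -- assemble
  have hexp : ⟪c + V x, g (x 2) • V x - g ((x + a) 2) • V (x + a) - F • e₂⟫ =
      g (x 2) * (‖V x‖ ^ 2 / 2) - g ((x + a) 2) * ⟪c + V x, V (x + a)⟫ - F * (c 2 + V x 2) := by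
    rw [inner_sub_right, inner_sub_right, real_inner_smul_right, real_inner_smul_right, real_inner_smul_right, hwV, hwe]
  rw [hexp, ha2]
  have h2 : g (x 2 - h) * ⟪c + V x, V (x + a)⟫ ≤ g (x 2 - h) * (‖V x‖ ^ 2 / 2) :=
    mul_le_mul_of_nonneg_left hT1 (hg0 _)
  nlinarith [hmono, h2, hT3, sq_nonneg ‖V x‖, hg0 (x 2 - h)]

end ExtremiserLiouville

end Summit.NavierStokesRegularity.NavierStokesRegularity.Theorems

end
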